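import Literature.AlgebraicGeometry.HodgeTheory.ArapuraSurfaceFibredFourfoldsSplit
import Literature.AlgebraicGeometry.HodgeTheory.ComplexConjugationHolds
import HarnessLib

/-!
# Arapura 2022, Thm. 1.2 on the smooth part of a `p_g = 0` surface fibration: proved reductions
# (proof file for `Arapura2022_thm_1_2_smoothPart_pgZeroSurfaceFibration`; no new named fact)

Family `hodge`, layer `Literature/AlgebraicGeometry/HodgeTheory`. Sibling proof file of
`ArapuraSurfaceFibredFourfoldsSplit.lean`, whose named fact
`Arapura2022_thm_1_2_smoothPart_pgZeroSurfaceFibration` is the `V`-part (layers 3–4) of the printed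
proof of D. Arapura, *Hodge cycles and the Leray filtration*, Pacific J. Math. 319 (2022) 233–258 =
arXiv:2103.05038, Cor. 1.5 (held copy read, pp. 3–5): for `f : X ⟶ Y` a surjective morphism with
connected fibres from a smooth projective fourfold onto a smooth projective surface whose general
fibre is a surface with `p_g = 0`, there is a proper Zariski-closed `T ⊊ Y` such that every rational
`(2,2)`-class of `X` agrees OFF `f⁻¹T` with an algebraic class ("the Hodge conjecture holds for
`V = f⁻¹(Y ∖ T)`", Thm. 1.2 with the computation of the proof of Cor. 1.5).

## What is proved here

The printed proof of Cor. 1.5 trivialises `R²f_*ℚ` by relative divisor classes only "after a finite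
base change" (p. 5: "It follows that, after a finite base change, `[𝒵_1], …, [𝒵_N]` gives a basis of
`R²f_*ℚ`"), applies Thm. 1.2 to the base-changed family `f' : X' ⟶ Y'`, and returns to `X` by the
trace of the generically finite map `g : X' ⟶ X`. For the PARENT fact (Cor. 1.5 itself) the return is
the tree's `hodgeClasses_algebraic_of_hasDegree` (`ArapuraSurfaceFibredFourfoldsProofs`). For the
present LOCALISED fact the return must moreover respect the open set `V = f⁻¹U`: this is

* `exists_mem_algebraicClasses_restrictCompl_eq_zero_of_hasDegree` — **localised algebraicity
  descends along morphisms of non-zero degree.** For `g : X' ⟶ X` of degree `d ≠ 0` between smooth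
  projective `n`-folds and `Z ⊆ X` Zariski-closed: if every rational `(p,p)`-class of `X'` agrees off
  `g⁻¹Z` with an algebraic class of `X'`, then every rational `(p,p)`-class `c` of `X` agrees off `Z`
  with an algebraic class of `X`. Proof: `g^*c` is rational of type `(p,p)` (`IsRationalClass.map`,
  `IsOfHodgeType.map_of_le`, the Hodge model of `X'` being the tree's theorem
  `nonempty_hodgeModel_holds`); if `g^*c - b'` dies off `g⁻¹Z` with `b'` algebraic, then
  `g_!(g^*c - b') = d • c - g_! b'` dies off `Z` (Gysin maps are compatible with restriction to open
  subsets: the tree's theorem `gysinMap_restrictCompl_eq_zero_of_field ℂ`, Fulton App. B §B.2 Ex. 5;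
  projection formula `g_! g^* c = d • c`, Fulton App. B (6)–(7) = `gysinMap_map_of_hasDegree`;
  Poincaré duality = the tree's `poincare_duality`), and `g_! b'` is algebraic
  (`gysinMap_mem_algebraicClasses_of_isSmoothProjective`, Voisin II Prop. 9.21 (ii)); so
  `b := d⁻¹ • g_! b'` does it.
* `Arapura2022_thm_1_2_smoothPart_pgZeroSurfaceFibration_of_cover` — **the fact after a finite base
  change**: the fact follows as soon as, for every `f` as in Cor. 1.5, there are a proper closed
  `T ⊊ Y` and SOME smooth projective fourfold `X'` mapping to `X` with non-zero degree whose rational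
  `(2,2)`-classes are algebraic off `g⁻¹f⁻¹T` (for the printed `X' → X ×_Y Y' → X`, `Y' → Y` finite
  and étale over `U = Y ∖ T`, the set `g⁻¹f⁻¹T = f'⁻¹(Y' ∖ U')` is the complement of the smooth part
  `V'` of the base-changed family, to which Thm. 1.2 is applied in print).
* `supportedClasses_eq_top_of_hasDegree` — **coniveau descends along morphisms of non-zero
  degree**: `Nʳ Hᵏ(X'(ℂ)) = Hᵏ(X'(ℂ))` implies `Nʳ Hᵏ(X(ℂ)) = Hᵏ(X(ℂ))` (same two ingredients).
* `Arapura2022_thm_1_2_smoothPart_pgZeroSurfaceFibration_of_supportedClasses_eq_top` — **the fact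
  from coniveau one of `H⁴` of a finite base change**: granted the Hodge conjecture in dimension
  `≤ 3`, Deligne's Cor. 8.2.8 and Voisin's Cor. 2.12 (three of the seven children of the split of
  Cor. 1.5, consumed by its assembly anyway), the fact holds — even with `T = ∅` — as soon as, for
  every `f` as in Cor. 1.5, some smooth projective fourfold `X'` mapping to `X` with non-zero degree
  has `N¹ H⁴(X'(ℂ); ℂ) = H⁴(X'(ℂ); ℂ)`: by the tree's PROVED descent of supported Hodge classes
  (`supportedHodgeClass_mem_algebraicClasses_of_hodgeConjectureFor_lt`, with projective Hironaka and
  Hodge models now theorems). This isolates what the Leray-spectral-sequence half of the printed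
  proof delivers for THIS corollary: with `U'` affine and `R²f'_*ℚ` trivialised by the relative
  divisors `𝒵_i`, Leray in degree `4` plus the first reflection of the proof of Thm. 1.2 (hard
  Lefschetz `∪h : R¹ ≅ R³` on the surface fibres) give
  `H⁴(V'(ℂ)) = f'^*H⁰ ∪ h² + h ∪ H²(V'(ℂ)) + Σ_i f'^*H²(U'(ℂ)) ∪ [𝒵_i]`, every summand of which
  dies on `V' ∖ (H ∪ ⋃_i 𝒵_i)`; so every class of `H⁴(X'(ℂ))` dies off a divisor — coniveau one,
  with no mixed Hodge theory needed (the docstring of the theorem has the details).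
* `map_cupProduct_map_eq_zero_of_restrictCompl_eq_zero`,
  `supportedClasses_eq_top_of_map_mem_span_cupProduct` — **"every summand dies off the divisor"**:
  for `D ⊆ X` Zariski-closed of codimension `≥ r`, `V ⊆ X(ℂ)` containing `(X ∖ D)(ℂ)` and classes
  `g_j` on `X(ℂ)` dying off `D`, a product `u ∪ g_j|_V` (`u ∈ H^*(V; ℂ)`) dies on `(X ∖ D)(ℂ)`
  (naturality of the cup product), so if the restriction to `V` of every class of `Hᵏ(X(ℂ); ℂ)`
  lies in the span of such products then `Nʳ Hᵏ(X(ℂ)) = Hᵏ(X(ℂ))`;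
  `Arapura2022_thm_1_2_smoothPart_pgZeroSurfaceFibration_of_map_mem_span_cupProduct` — the fact
  (granted `h3`, `hD`, `hV`) from that generation property for `k = 4` on some `X'` of non-zero
  degree over `X`, with `V = V'(ℂ)`, `D = f'⁻¹(Y' ∖ U') ∪ H ∪ ⋃_i 𝒵_i`, `g = (h, [𝒵_i])`: the
  purely topological Leray statement `H⁴(V'(ℂ)) = h ∪ H²(V'(ℂ)) + Σ_i H²(V'(ℂ)) ∪ [𝒵_i]|` is now
  the ONLY input asked of the spectral sequence.

What is NOT here (and why the fact is not discharged): that topological Leray statement for the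
base-changed family (the Leray spectral sequence of `V'(ℂ) → U'(ℂ)` with the local systems `R¹`,
`R³`, relative hard Lefschetz on the surface fibres, Andreotti–Frankel for the affine `U'`), the
existence of the finite base change (finite monodromy on `NS(X_y) = H²(X_y)`, Riemann's existence
theorem, relative divisors) and Lefschetz `(1,1)` on the fibres and on `X'` (the tree's UNPROVED
named fact `lefschetzOneOne_rational`) — none of which has a carrier in the tree yet (module
docstring of `ArapuraSurfaceFibredFourfoldsSplit.lean`).

No definition and no named fact is introduced (D-0026).

## References

* [Arapura2022] D. Arapura, *Hodge cycles and the Leray filtration*, Pacific J. Math. 319 (2022)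
  233–258 = arXiv:2103.05038: Thm. 1.2, Cor. 1.4 and the proof of Cor. 1.5 (p. 5).
* [FultonYoungTableaux1997] W. Fulton, *Young Tableaux*, App. B §B.1 (5)–(7), §B.2 Exercise 5.
* [VoisinHodgeII2003] C. Voisin, *Hodge Theory and Complex Algebraic Geometry II*, Prop. 9.21 (ii).
* [VoisinHodgeI2002] C. Voisin, *Hodge Theory and Complex Algebraic Geometry I*, §7.3.2.
* [HatcherAT2002] A. Hatcher, *Algebraic Topology*, §3.3 Thm. 3.30.
* [Voisin2025] C. Voisin, *Hodge and generalized Hodge conjectures, coniveau and algebraic cycles*,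
  J. Open Math. Probl. 1 (2025), Cor. 2.12, Thm. 4.4, Cor. 4.5.
* [DeligneHodgeIII1974] P. Deligne, *Théorie de Hodge III*, Publ. Math. IHÉS 44 (1974), Cor. 8.2.8.
-/

noncomputable section

open AlgebraicGeometry
open Literature.AlgebraicTopology.SingularHomology

namespace Literature.AlgebraicGeometry.HodgeTheory

section HodgeTheory

variable {n : ℕ} {X X' : Motives.SchemeOver ℂ}

/-! ### Localised algebraicity descends along morphisms of non-zero degree -/

/-- **Support transfer for the Gysin homomorphism of `g : X' ⟶ X`** (smooth projective `n`-folds):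
a class on `X'(ℂ)` dying on `(X' ∖ g⁻¹Z)(ℂ)`, `Z ⊆ X` Zariski-closed, has Gysin image dying on
`(X ∖ Z)(ℂ)` — the tree's theorem `gysinMap_restrictCompl_eq_zero_of_field ℂ` (Gysin maps are
compatible with restriction to open subsets) for the continuous map `g(ℂ)` of the closed oriented
manifolds `X'(ℂ)`, `X(ℂ)` and the closed subset `{Q | pt Q ∈ Z}` of `X(ℂ)`; Poincaré duality for the
orientation `ν` of `X(ℂ)` is the tree's `poincare_duality`.
[cite: FultonYoungTableaux1997, Appendix B §B.2 Exercise 5] [cite: HatcherAT2002, §3.3 Thm. 3.30] -/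
theorem restrictCompl_gysinMap_eq_zero_of_preimage (hX' : Motives.IsSmoothProjective n X')
    (hX : Motives.IsSmoothProjective n X) (g : X' ⟶ X)
    (μ : HomologicalOrientation ℂ (Motives.ComplexPoints X') (2 * n))
    (ν : HomologicalOrientation ℂ (Motives.ComplexPoints X) (2 * n))
    {Z : Set X.left} (hZ : IsClosed Z) {a q : ℕ} (h : a + q = 2 * n) {y : complexBetti X' a}
    (hy : complexBetti.restrictCompl X' (g.left.base ⁻¹' Z) a y = 0) :
    complexBetti.restrictCompl X Z a
      (gysinMap μ ν (Motives.AlgPoints.mapContinuous (L := ℂ) g) h h y) = 0 := by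
  letI := hX'.chartedSpace
  letI := hX.chartedSpace
  haveI := Motives.ComplexPoints.compactSpace_of_isSmoothProjective hX'
  haveI := Motives.ComplexPoints.t2Space_of_isSmoothProjective hX'
  haveI := Motives.ComplexPoints.compactSpace_of_isSmoothProjective hX
  haveI := Motives.ComplexPoints.t2Space_of_isSmoothProjective hX
  -- Poincaré duality for `X(ℂ)` (Hatcher Thm. 3.30, proved in the tree)
  have hν : ν.HasPoincareDuality := fun _ _ h' ↦
    Motives.ComplexPoints.bijective_poincareDualityMap_of (fun ν' _ _ h'' ↦ poincare_duality ν' h'')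
      hX ν h'
  exact gysinMap_restrictCompl_eq_zero_of_field ℂ μ ν hν (Motives.AlgPoints.mapContinuous (L := ℂ) g)
    h h (K := {Q : Motives.ComplexPoints X | Q.pt ∈ Z}) (isClosed_setOf_pt_mem hZ) y hy

/-- **Localised algebraicity descends along morphisms of non-zero degree** ("after a finite base
change", for the `V`-part). Let `g : X' ⟶ X` be a `ℂ`-morphism of smooth projective varieties of
the same dimension `n` whose continuous map `g(ℂ)` has degree `d ≠ 0` (`g(ℂ)_*[X'(ℂ)] = d • [X(ℂ)]`,
`HasDegree`), and let `Z ⊆ X` be Zariski-closed. If every rational class of Hodge type `(p,p)` in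
`H²ᵖ(X'(ℂ); ℂ)` agrees off `g⁻¹Z` with an algebraic class of `X'`, then every rational class `c` of
Hodge type `(p,p)` in `H²ᵖ(X(ℂ); ℂ)` agrees off `Z` with an algebraic class of `X`. Proof: `g^* c` is
rational (`IsRationalClass.map`) of type `(p,p)` (`IsOfHodgeType.map_of_le`, Voisin I §7.3.2, with a
Hodge model of `X'` from the tree's theorem `nonempty_hodgeModel_holds`); with `b'` algebraic and
`g^* c - b'` dying off `g⁻¹Z`, the class `g_!(g^* c - b') = d • c - g_! b'` dies off `Z`
(`restrictCompl_gysinMap_eq_zero_of_preimage`; projection formula `g_! g^* c = d • c`, Fulton App. B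
(6)–(7)) and `g_! b'` is algebraic (`gysinMap_mem_algebraicClasses_of_isSmoothProjective`, Voisin II
Prop. 9.21 (ii)); take `b = d⁻¹ • g_! b'`. In degrees `2p > 2n` there is nothing to prove.
[cite: Arapura2022, proof of Cor. 1.5 (p. 5): "after a finite base change"]
[cite: FultonYoungTableaux1997, Appendix B §B.1 (5)–(7) and §B.2 Exercise 5]
[cite: VoisinHodgeII2003, §9.2.4 Prop. 9.21 (ii)] [cite: VoisinHodgeI2002, §7.3.2] -/
theorem exists_mem_algebraicClasses_restrictCompl_eq_zero_of_hasDegree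
    (hX' : Motives.IsSmoothProjective n X') (hX : Motives.IsSmoothProjective n X) (g : X' ⟶ X)
    (μ : HomologicalOrientation ℂ (Motives.ComplexPoints X') (2 * n))
    (ν : HomologicalOrientation ℂ (Motives.ComplexPoints X) (2 * n)) {d : ℤ} (hd : d ≠ 0)
    (hg : HasDegree μ ν (Motives.AlgPoints.mapContinuous (L := ℂ) g) d)
    {Z : Set X.left} (hZ : IsClosed Z) {p : ℕ}
    (h' : ∀ c' : complexBetti X' (2 * p), IsRationalClass c' → IsOfHodgeType n X' (2 * p) p p c' →
      ∃ b' ∈ algebraicClasses X' p,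
        complexBetti.restrictCompl X' (g.left.base ⁻¹' Z) (2 * p) (c' - b') = 0)
    {c : complexBetti X (2 * p)} (hc : IsRationalClass c) (hpp : IsOfHodgeType n X (2 * p) p p c) :
    ∃ b ∈ algebraicClasses X p, complexBetti.restrictCompl X Z (2 * p) (c - b) = 0 := by
  by_cases hp : p ≤ n
  · -- Poincaré duality for `X(ℂ)` (Hatcher Thm. 3.30, proved in the tree)
    have hν : ν.HasPoincareDuality := fun _ _ h' ↦
      Motives.ComplexPoints.bijective_poincareDualityMap_of (fun ν' _ _ h'' ↦ poincare_duality ν' h'')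
        hX ν h'
    have h : 2 * p + (2 * n - 2 * p) = 2 * n := by omega
    -- a Hodge model of the cover (GAGA + the Hodge decomposition, proved in the tree)
    obtain ⟨B⟩ := nonempty_hodgeModel_holds (n := n) (X := X') hX'
    -- the localised statement on `X'` for `g^* c`
    obtain ⟨b', hb', hcb'⟩ := h' _ (hc.map (Motives.AlgPoints.mapContinuous (L := ℂ) g))
      (hpp.map_of_le hX' hX B g le_rfl)
    refine ⟨(d : ℂ)⁻¹ • gysinMap μ ν (Motives.AlgPoints.mapContinuous (L := ℂ) g) h h b',
      Submodule.smul_mem _ _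
        (gysinMap_mem_algebraicClasses_of_isSmoothProjective hX' hX μ ν hν g h h rfl hb'), ?_⟩
    -- `c - d⁻¹ • g_! b' = d⁻¹ • g_!(g^* c - b')`
    have key : c - (d : ℂ)⁻¹ • gysinMap μ ν (Motives.AlgPoints.mapContinuous (L := ℂ) g) h h b' =
        (d : ℂ)⁻¹ • gysinMap μ ν (Motives.AlgPoints.mapContinuous (L := ℂ) g) h h
          (singularCohomology.map ℂ ℂ (Motives.AlgPoints.mapContinuous (L := ℂ) g) (2 * p) c - b') := by
      rw [map_sub, gysinMap_map_of_hasDegree hν hg h c, smul_sub, ← Int.cast_smul_eq_zsmul ℂ d c,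
        smul_smul, inv_mul_cancel₀ (Int.cast_ne_zero.2 hd), one_smul]
    rw [key, map_smul, restrictCompl_gysinMap_eq_zero_of_preimage hX' hX g μ ν hZ h hcb', smul_zero]
  · -- `2p > 2n`: `H²ᵖ(X(ℂ); ℂ) = 0`
    haveI := subsingleton_complexBetti hX (k := 2 * p) (by omega)
    refine ⟨0, Submodule.zero_mem _, ?_⟩
    rw [Subsingleton.elim (c - 0) 0, map_zero]

/-! ### The fact after a finite base change -/

/-- **Thm. 1.2 on the smooth part, after a finite base change.** The named fact
`Arapura2022_thm_1_2_smoothPart_pgZeroSurfaceFibration` follows as soon as, for every fibration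
`f : X ⟶ Y` as in Cor. 1.5, there are a proper Zariski-closed `T ⊊ Y` and SOME smooth projective
fourfold `X'` with a morphism `g : X' ⟶ X` of non-zero degree such that every rational
`(2,2)`-class of `X'` agrees off `g⁻¹(f⁻¹T)` with an algebraic class of `X'` — the form in which the
printed proof uses its finite base change: for `Y' → Y` finite, étale over `U = Y ∖ T`, and `X'` a
desingularised `X ×_Y Y'`, the closed set `g⁻¹f⁻¹T = f'⁻¹(Y' ∖ U')` is the complement of the smooth
part `V' = f'⁻¹U'` of the base-changed family, for which the surjectivity hypothesis of Thm. 1.2 is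
verified on p. 5 ("after a finite base change, `[𝒵_1], …, [𝒵_N]` gives a basis of `R²f_*ℚ`"). The
return to `X` is `exists_mem_algebraicClasses_restrictCompl_eq_zero_of_hasDegree`.
[cite: Arapura2022, Thm. 1.2, Cor. 1.4 and proof of Cor. 1.5 (p. 5)] -/
theorem Arapura2022_thm_1_2_smoothPart_pgZeroSurfaceFibration_of_cover
    (hcov : ∀ ⦃X Y : Motives.SchemeOver ℂ⦄ (f : X ⟶ Y),
      Motives.IsSmoothProjective 4 X → Motives.IsSmoothProjective 2 Y →
      Function.Surjective f.left.base →
      (∀ y : Y.left, IsPreconnected (f.left.base ⁻¹' {y})) →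
      (∃ T : Set Y.left, IsClosed T ∧ T ≠ Set.univ ∧
        ∀ s : Motives.AlgPoints Y ℂ, s.pt ∉ T →
          Motives.IsSmoothProjective 2 (Motives.fiberOver f s) ∧
          ∃ A : HodgeModel 2 (Motives.fiberOver f s), Module.finrank ℂ ↥(A.hodgePQ 2 2 0) = 0) →
      ∃ T : Set Y.left, IsClosed T ∧ T ≠ Set.univ ∧
        ∃ (X' : Motives.SchemeOver ℂ) (g : X' ⟶ X) (_ : Motives.IsSmoothProjective 4 X')
          (μ : HomologicalOrientation ℂ (Motives.ComplexPoints X') (2 * 4))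
          (ν : HomologicalOrientation ℂ (Motives.ComplexPoints X) (2 * 4)) (d : ℤ),
          d ≠ 0 ∧ HasDegree μ ν (Motives.AlgPoints.mapContinuous (L := ℂ) g) d ∧
          ∀ c' : complexBetti X' (2 * 2), IsRationalClass c' → IsOfHodgeType 4 X' (2 * 2) 2 2 c' →
            ∃ b' ∈ algebraicClasses X' 2,
              complexBetti.restrictCompl X' (g.left.base ⁻¹' (f.left.base ⁻¹' T)) (2 * 2)
                (c' - b') = 0) :
    Arapura2022_thm_1_2_smoothPart_pgZeroSurfaceFibration := by
  intro X Y f hX hY hf hconn hgen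
  obtain ⟨T, hT, hTne, X', g, hX', μ, ν, d, hd, hg, h'⟩ := hcov f hX hY hf hconn hgen
  refine ⟨T, hT, hTne, fun c hc hpp ↦ ?_⟩
  have hZ : IsClosed (f.left.base ⁻¹' T) := hT.preimage f.left.continuous
  exact exists_mem_algebraicClasses_restrictCompl_eq_zero_of_hasDegree hX' hX g μ ν hd hg hZ h' hc hpp

/-! ### The fact from coniveau one of `H⁴` of a finite base change -/

/-- **Coniveau descends along morphisms of non-zero degree.** For `g : X' ⟶ X` of degree `d ≠ 0`
between smooth projective `n`-folds, if every class of `Hᵏ(X'(ℂ); ℂ)` is supported in codimension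
`≥ r` (`Nʳ Hᵏ(X'(ℂ)) = Hᵏ(X'(ℂ))`), then so is every class of `Hᵏ(X(ℂ); ℂ)`: `x = d⁻¹ • g_!(g^* x)`
(projection formula, Fulton App. B (6)–(7)) and the Gysin homomorphism of `g` maps `Nʳ Hᵏ(X'(ℂ))`
into `Nʳ Hᵏ(X(ℂ))` (the tree's `gysinMap_mem_supportedClasses_of_isSmoothProjective`, Voisin II
Prop. 9.21 (ii) on the coniveau carrier). [cite: FultonYoungTableaux1997, Appendix B §B.1 (5)–(7)]
[cite: VoisinHodgeII2003, §9.2.4 Prop. 9.21 (ii)] -/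
theorem supportedClasses_eq_top_of_hasDegree (hX' : Motives.IsSmoothProjective n X')
    (hX : Motives.IsSmoothProjective n X) (g : X' ⟶ X)
    (μ : HomologicalOrientation ℂ (Motives.ComplexPoints X') (2 * n))
    (ν : HomologicalOrientation ℂ (Motives.ComplexPoints X) (2 * n)) {d : ℤ} (hd : d ≠ 0)
    (hg : HasDegree μ ν (Motives.AlgPoints.mapContinuous (L := ℂ) g) d) {k r : ℕ}
    (h : supportedClasses X' k r = ⊤) : supportedClasses X k r = ⊤ := by
  refine eq_top_iff.2 fun x _ ↦ ?_
  by_cases hk : k ≤ 2 * n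
  · -- Poincaré duality for `X(ℂ)` (Hatcher Thm. 3.30, proved in the tree)
    have hν : ν.HasPoincareDuality := fun _ _ h' ↦
      Motives.ComplexPoints.bijective_poincareDualityMap_of (fun ν' _ _ h'' ↦ poincare_duality ν' h'')
        hX ν h'
    have hq : k + (2 * n - k) = 2 * n := by omega
    have hx' : singularCohomology.map ℂ ℂ (Motives.AlgPoints.mapContinuous (L := ℂ) g) k x ∈
        supportedClasses X' k r := h ▸ Submodule.mem_top
    have hgx := gysinMap_mem_supportedClasses_of_isSmoothProjective hX' hX μ ν hν g hq hq
      (add_comm r n).le hx'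
    rw [gysinMap_map_of_hasDegree hν hg hq x, ← Int.cast_smul_eq_zsmul ℂ d x] at hgx
    exact ((supportedClasses X k r).smul_mem_iff (Int.cast_ne_zero.2 hd)).1 hgx
  · haveI := subsingleton_complexBetti hX (k := k) (by omega)
    rw [Subsingleton.elim x 0]
    exact Submodule.zero_mem _

/-- **Thm. 1.2 on the smooth part from coniveau one of `H⁴` of a finite base change.** Granted the
Hodge conjecture in dimension `≤ 3` (`h3`), Deligne's Cor. 8.2.8 (`hD`) and Voisin's Cor. 2.12
(`hV`) — three of the seven children of the split of Cor. 1.5, all consumed by its assembly anyway —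
the `V`-part `Arapura2022_thm_1_2_smoothPart_pgZeroSurfaceFibration` follows (even with `T = ∅`)
as soon as, for every fibration `f : X ⟶ Y` as in Cor. 1.5, SOME smooth projective fourfold `X'`
mapping to `X` with non-zero degree has ALL of `H⁴(X'(ℂ); ℂ)` supported in codimension `≥ 1`
(`N¹ H⁴(X'(ℂ)) = H⁴(X'(ℂ))`, `hN`). Indeed coniveau one descends to `X`
(`supportedClasses_eq_top_of_hasDegree`), and a rational `(2,2)`-class of coniveau `≥ 1` on a
fourfold is algebraic by the tree's PROVED descent of supported Hodge classes
(`supportedHodgeClass_mem_algebraicClasses_of_hodgeConjectureFor_lt`: Hironaka resolutions of the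
support — `Resolution.Hironaka1964_projective_holds` —, `hD`, `hV`, and the Hodge conjecture on
the resolved threefolds, `hodgeConjectureFor_of_lt_four h3` with Hodge models from
`nonempty_hodgeModel_holds`).

Why `hN` is what the printed proof establishes. For the base-changed family `f' : X' ⟶ Y'` of
the proof of Cor. 1.5 (`U' ⊆ Y'` affine, `f'` smooth over `U'`, `V' = f'⁻¹U'`, relative divisors
`𝒵_1, …, 𝒵_N` whose classes restrict to a basis of `H²` of every fibre, `h = c₁(𝒪_X'(1))`), the
Leray spectral sequence of `V'(ℂ) → U'(ℂ)` (Ehresmann; `E₂^{p,q} = Hᵖ(U', R^q f'_*ℚ)`, `p ≤ 2`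
by Andreotti–Frankel) gives, in degree `4` and with the first reflection of the proof of Thm. 1.2
(hard Lefschetz `∪h : R¹ ≅ R³` on the surface fibres; the second reflection is vacuous for `U'`
affine), `H⁴(V'(ℂ)) = f'^*H⁰(U') ∪ h² + h ∪ H²(V'(ℂ)) + Σ_i f'^*H²(U'(ℂ)) ∪ [𝒵_i]`; every summand
dies on `V' ∖ (H ∪ ⋃_i 𝒵_i)`, so every class of `H⁴(X'(ℂ))` dies off the divisor
`f'⁻¹(Y' ∖ U') ∪ H ∪ ⋃_i 𝒵_i`, i.e. `N¹ H⁴(X'(ℂ)) = H⁴(X'(ℂ))` (as the generalised Hodge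
conjecture predicts: `p_g(X') = 0` since `f'_* K_{X'/Y'} = 0`). That topological statement (Leray
with the local systems `R¹`, `R³`; no mixed Hodge theory is needed for it) and the existence of the
base change (finite monodromy on `NS`, Riemann's existence theorem, Lefschetz `(1,1)`) are what
remains; neither has a carrier in the tree yet.
[cite: Arapura2022, Thm. 1.2 (proof, first reflection), Cor. 1.4 and proof of Cor. 1.5 (p. 5)]
[cite: Voisin2025, Cor. 2.12, Thm. 4.4 and Cor. 4.5] [cite: DeligneHodgeIII1974, Cor. 8.2.8] -/
theorem Arapura2022_thm_1_2_smoothPart_pgZeroSurfaceFibration_of_supportedClasses_eq_top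
    (h3 : hodgeClasses_algebraic_of_dim_le_three)
    (hD : Deligne1974_ker_restrictCompl_eq_iSup_range_complexGysin)
    (hV : Voisin2025_hodgeClass_lift_complexGysin)
    (hN : ∀ ⦃X Y : Motives.SchemeOver ℂ⦄ (f : X ⟶ Y),
      Motives.IsSmoothProjective 4 X → Motives.IsSmoothProjective 2 Y →
      Function.Surjective f.left.base →
      (∀ y : Y.left, IsPreconnected (f.left.base ⁻¹' {y})) →
      (∃ T : Set Y.left, IsClosed T ∧ T ≠ Set.univ ∧
        ∀ s : Motives.AlgPoints Y ℂ, s.pt ∉ T →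
          Motives.IsSmoothProjective 2 (Motives.fiberOver f s) ∧
          ∃ A : HodgeModel 2 (Motives.fiberOver f s), Module.finrank ℂ ↥(A.hodgePQ 2 2 0) = 0) →
      ∃ (X' : Motives.SchemeOver ℂ) (g : X' ⟶ X) (_ : Motives.IsSmoothProjective 4 X')
        (μ : HomologicalOrientation ℂ (Motives.ComplexPoints X') (2 * 4))
        (ν : HomologicalOrientation ℂ (Motives.ComplexPoints X) (2 * 4)) (d : ℤ),
        d ≠ 0 ∧ HasDegree μ ν (Motives.AlgPoints.mapContinuous (L := ℂ) g) d ∧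
        supportedClasses X' (2 * 2) 1 = ⊤) :
    Arapura2022_thm_1_2_smoothPart_pgZeroSurfaceFibration := by
  intro X Y f hX hY hf hconn hgen
  obtain ⟨X', g, hX', μ, ν, d, hd, hg, hN'⟩ := hN f hX hY hf hconn hgen
  haveI : IsIntegral Y.left := Motives.IsSmoothProjective.isIntegral_holds hY
  refine ⟨∅, isClosed_empty, Set.empty_ne_univ, fun c hc hpp ↦ ?_⟩
  obtain ⟨μ₀, hμ₀⟩ := exists_orientationFamily_hasPoincareDuality
  -- coniveau one on `X` itself, then descent of supported Hodge classes
  have hN₀ : supportedClasses X (2 * 2) 1 = ⊤ :=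
    supportedClasses_eq_top_of_hasDegree hX' hX g μ ν hd hg hN'
  have halg : c ∈ algebraicClasses X 2 :=
    supportedHodgeClass_mem_algebraicClasses_of_hodgeConjectureFor_lt hD hV
      Resolution.Hironaka1964_projective_holds (gysinMap_restrictCompl_eq_zero_of_field ℂ) μ₀ hμ₀
      hX (hodgeConjectureFor_of_lt_four h3 fun _ _ ↦ nonempty_hodgeModel_holds) 2 c hc hpp
      (hN₀ ▸ Submodule.mem_top)
  exact ⟨c, halg, by rw [sub_self, map_zero]⟩

/-! ### Coniveau from generation, over a Zariski-open set, by classes dying off a closed set -/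

/-- **A product with a class dying off `D` dies off `D`** (computed on any subset `V ⊆ X(ℂ)`
containing `(X ∖ D)(ℂ)`). For `D ⊆ X`, a subset `V` of `X(ℂ)` containing every complex point off
`D`, a class `u ∈ Hᵖ(V; ℂ)` and a class `g ∈ Hᵠ(X(ℂ); ℂ)` whose restriction to `(X ∖ D)(ℂ)`
vanishes, the product `u ∪ g|_V ∈ Hᵖ⁺ᵠ(V; ℂ)` restricts to zero on `(X ∖ D)(ℂ)`: restriction is
a ring homomorphism (naturality of the cup product, Hatcher 2002, Prop. 3.10 = the tree's
`cupProduct_map`) and `g` restricts to zero there. This is the elementary half of "every summand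
of `H⁴(V'(ℂ)) = f'^*H⁰ ∪ h² + h ∪ H²(V'(ℂ)) + Σ_i f'^*H²(U'(ℂ)) ∪ [𝒵_i]` dies on
`V' ∖ (H ∪ ⋃_i 𝒵_i)`" in the coniveau form of the proof of Cor. 1.5 (docstring of
`Arapura2022_thm_1_2_smoothPart_pgZeroSurfaceFibration_of_supportedClasses_eq_top`).
[cite: HatcherAT2002, §3.2 Prop. 3.10] [cite: GrothendieckTopology1969, §1] -/
theorem map_cupProduct_map_eq_zero_of_restrictCompl_eq_zero {D : Set X.left}
    {V : Set (Motives.ComplexPoints X)} (hDV : ∀ P : Motives.ComplexPoints X, P.pt ∉ D → P ∈ V)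
    {p q k : ℕ} (hpq : p + q = k) (u : singularCohomology ℂ ℂ ↥V p) {g : complexBetti X q}
    (hg : complexBetti.restrictCompl X D q g = 0) :
    singularCohomology.map ℂ ℂ (⟨fun P ↦ ⟨P.1, hDV P.1 P.2⟩, by fun_prop⟩ :
        C(Motives.complexPointsCompl X D, ↥V)) k
      (cupProduct hpq u (singularCohomology.map ℂ ℂ
        (⟨Subtype.val, continuous_subtype_val⟩ : C(↥V, Motives.ComplexPoints X)) q g)) = 0 := by
  set iW : C(Motives.complexPointsCompl X D, ↥V) := ⟨fun P ↦ ⟨P.1, hDV P.1 P.2⟩, by fun_prop⟩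
  set iV : C(↥V, Motives.ComplexPoints X) := ⟨Subtype.val, continuous_subtype_val⟩
  have hcomp : iV.comp iW = (⟨Subtype.val, continuous_subtype_val⟩ :
      C(Motives.complexPointsCompl X D, Motives.ComplexPoints X)) := rfl
  have hg' : singularCohomology.map ℂ ℂ iW q (singularCohomology.map ℂ ℂ iV q g) = 0 := by
    rw [← ModuleCat.comp_apply, ← singularCohomology.map_comp, hcomp]
    exact hg
  rw [cupProduct_map, hg', map_zero]

/-- The same with the factors exchanged: `g|_V ∪ u` dies off `D` when `g` does.
[cite: HatcherAT2002, §3.2 Prop. 3.10] [cite: GrothendieckTopology1969, §1] -/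
theorem map_cupProduct_map_eq_zero_of_restrictCompl_eq_zero' {D : Set X.left}
    {V : Set (Motives.ComplexPoints X)} (hDV : ∀ P : Motives.ComplexPoints X, P.pt ∉ D → P ∈ V)
    {p q k : ℕ} (hqp : q + p = k) (u : singularCohomology ℂ ℂ ↥V p) {g : complexBetti X q}
    (hg : complexBetti.restrictCompl X D q g = 0) :
    singularCohomology.map ℂ ℂ (⟨fun P ↦ ⟨P.1, hDV P.1 P.2⟩, by fun_prop⟩ :
        C(Motives.complexPointsCompl X D, ↥V)) k
      (cupProduct hqp (singularCohomology.map ℂ ℂ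
        (⟨Subtype.val, continuous_subtype_val⟩ : C(↥V, Motives.ComplexPoints X)) q g) u) = 0 := by
  set iW : C(Motives.complexPointsCompl X D, ↥V) := ⟨fun P ↦ ⟨P.1, hDV P.1 P.2⟩, by fun_prop⟩
  set iV : C(↥V, Motives.ComplexPoints X) := ⟨Subtype.val, continuous_subtype_val⟩
  have hcomp : iV.comp iW = (⟨Subtype.val, continuous_subtype_val⟩ :
      C(Motives.complexPointsCompl X D, Motives.ComplexPoints X)) := rfl
  have hg' : singularCohomology.map ℂ ℂ iW q (singularCohomology.map ℂ ℂ iV q g) = 0 := by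
    rw [← ModuleCat.comp_apply, ← singularCohomology.map_comp, hcomp]
    exact hg
  rw [cupProduct_map, hg', LinearMap.map_zero₂]

/-- **Coniveau `≥ r` from generation over a Zariski-open set by classes dying off a closed set of
codimension `≥ r`.** Let `D ⊆ X` be Zariski-closed with all its points of codimension `≥ r`, let
`V ⊆ X(ℂ)` contain `(X ∖ D)(ℂ)` (typically `V = V'(ℂ)` for a Zariski-open `V' ⊇ X ∖ D`), and let
`g_j ∈ H^{d_j}(X(ℂ); ℂ)` be classes dying on `(X ∖ D)(ℂ)` (e.g. the class of a hyperplane section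
`H ⊆ D` and divisor classes `[𝒵_i]`, `𝒵_i ⊆ D`). If the restriction to `V` of EVERY class of
`Hᵏ(X(ℂ); ℂ)` lies in the degree-`k` part of the ideal of `H^*(V; ℂ)` generated by the `g_j|_V`
— i.e. in the `ℂ`-span of the products `u ∪ g_j|_V`, `u ∈ H^{k-d_j}(V; ℂ)` — then
`Nʳ Hᵏ(X(ℂ); ℂ) = Hᵏ(X(ℂ); ℂ)`: every such product dies on `(X ∖ D)(ℂ)`
(`map_cupProduct_map_eq_zero_of_restrictCompl_eq_zero`), so every class of `Hᵏ(X(ℂ))` dies off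
`D`. This is the passage "every summand dies on `V' ∖ (H ∪ ⋃_i 𝒵_i)`, so every class of
`H⁴(X'(ℂ))` dies off the divisor `f'⁻¹(Y' ∖ U') ∪ H ∪ ⋃_i 𝒵_i`, i.e. `N¹ H⁴(X'(ℂ)) = H⁴(X'(ℂ))`"
of the coniveau form of the proof of Cor. 1.5; the Leray-spectral-sequence input is isolated as
the hypothesis `hgen`. [cite: Arapura2022, proof of Cor. 1.5 (p. 5) with Thm. 1.2 (proof, first
reflection)] [cite: GrothendieckTopology1969, §1] [cite: HatcherAT2002, §3.2 Prop. 3.10] -/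
theorem supportedClasses_eq_top_of_map_mem_span_cupProduct {k r : ℕ} {D : Set X.left}
    (hDc : IsClosed D) (hr : ∀ z ∈ D, (r : ℕ∞) ≤ Order.coheight z)
    {V : Set (Motives.ComplexPoints X)} (hDV : ∀ P : Motives.ComplexPoints X, P.pt ∉ D → P ∈ V)
    {ι : Type*} {d : ι → ℕ} (g : ∀ j, complexBetti X (d j))
    (hg : ∀ j, complexBetti.restrictCompl X D (d j) (g j) = 0)
    (hgen : ∀ c : complexBetti X k,
      singularCohomology.map ℂ ℂ
          (⟨Subtype.val, continuous_subtype_val⟩ : C(↥V, Motives.ComplexPoints X)) k c ∈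
        Submodule.span ℂ {x | ∃ (j : ι) (p : ℕ) (hpk : p + d j = k)
          (u : singularCohomology ℂ ℂ ↥V p),
          cupProduct hpk u (singularCohomology.map ℂ ℂ
            (⟨Subtype.val, continuous_subtype_val⟩ : C(↥V, Motives.ComplexPoints X))
              (d j) (g j)) = x}) :
    supportedClasses X k r = ⊤ := by
  refine eq_top_iff.2 fun c _ ↦ mem_supportedClasses_of_restrictCompl_eq_zero hDc hr ?_
  set iW : C(Motives.complexPointsCompl X D, ↥V) := ⟨fun P ↦ ⟨P.1, hDV P.1 P.2⟩, by fun_prop⟩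
  set iV : C(↥V, Motives.ComplexPoints X) := ⟨Subtype.val, continuous_subtype_val⟩
  have hcomp : iV.comp iW = (⟨Subtype.val, continuous_subtype_val⟩ :
      C(Motives.complexPointsCompl X D, Motives.ComplexPoints X)) := rfl
  -- every generator dies on `(X ∖ D)(ℂ)`, hence so does the span
  have hle : Submodule.span ℂ {x | ∃ (j : ι) (p : ℕ) (hpk : p + d j = k)
        (u : singularCohomology ℂ ℂ ↥V p),
        cupProduct hpk u (singularCohomology.map ℂ ℂ iV (d j) (g j)) = x} ≤
      LinearMap.ker (singularCohomology.map ℂ ℂ iW k).hom := by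
    refine Submodule.span_le.2 ?_
    rintro x ⟨j, p, hpk, u, rfl⟩
    exact map_cupProduct_map_eq_zero_of_restrictCompl_eq_zero hDV hpk u (hg j)
  have h := hle (hgen c)
  rw [LinearMap.mem_ker] at h
  -- `c|_{(X ∖ D)(ℂ)} = (c|_V)|_{(X ∖ D)(ℂ)}`
  rw [complexBetti.restrictCompl, ← hcomp, singularCohomology.map_comp, ModuleCat.comp_apply]
  exact h

/-- **Thm. 1.2 on the smooth part from generation of `H⁴` of a finite base change, over a
Zariski-open set, by classes dying off a divisor.** Granted the Hodge conjecture in dimension `≤ 3`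
(`h3`), Deligne's Cor. 8.2.8 (`hD`) and Voisin's Cor. 2.12 (`hV`), the `V`-part
`Arapura2022_thm_1_2_smoothPart_pgZeroSurfaceFibration` follows as soon as, for every fibration
`f : X ⟶ Y` as in Cor. 1.5, SOME smooth projective fourfold `X'` mapping to `X` with non-zero
degree carries a proper Zariski-closed `D ⊊ X'`, a subset `V ⊆ X'(ℂ)` containing `(X' ∖ D)(ℂ)`
and finitely many classes `g_j ∈ H^{d_j}(X'(ℂ); ℂ)` dying off `D`, such that the restriction to
`V` of every class of `H⁴(X'(ℂ); ℂ)` lies in the span of the products `u ∪ g_j|_V`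
(`supportedClasses_eq_top_of_map_mem_span_cupProduct`: then `N¹ H⁴(X'(ℂ)) = H⁴(X'(ℂ))`, the
points of the proper closed `D` having codimension `≥ 1` in the irreducible `X'`, and
`Arapura2022_thm_1_2_smoothPart_pgZeroSurfaceFibration_of_supportedClasses_eq_top` applies).
This is the exact shape in which the printed proof is consumed: for the base-changed family
`f' : X' ⟶ Y'` of the proof of Cor. 1.5 take `V = V'(ℂ)`, `V' = f'⁻¹U'` (`U'` affine, `f'` smooth
over `U'`), `D = f'⁻¹(Y' ∖ U') ∪ H ∪ ⋃_i 𝒵_i` and `g = (h, [𝒵_1], …, [𝒵_N])` (the hyperplane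
class and the relative divisor classes, which die off `H`, resp. `𝒵_i`); the Leray spectral
sequence of `V'(ℂ) → U'(ℂ)` with hard Lefschetz `∪h : R¹ ≅ R³` on the surface fibres (Thm. 1.2,
proof, first reflection; `p ≤ 2` by Andreotti–Frankel for the affine `U'`) gives
`H⁴(V'(ℂ)) = h ∪ H²(V'(ℂ)) + Σ_i H²(V'(ℂ)) ∪ [𝒵_i]|_{V'}` (the summand `f'^*H⁰ ∪ h²` being
`h ∪ (λ h)`), which is hypothesis `hgen`. What remains for the fact is that topological statement
and the existence of the base change (module docstring).
[cite: Arapura2022, Thm. 1.2 (proof, first reflection), Cor. 1.4 and proof of Cor. 1.5 (p. 5)]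
[cite: Voisin2025, Cor. 2.12, Thm. 4.4 and Cor. 4.5] [cite: DeligneHodgeIII1974, Cor. 8.2.8] -/
theorem Arapura2022_thm_1_2_smoothPart_pgZeroSurfaceFibration_of_map_mem_span_cupProduct
    (h3 : hodgeClasses_algebraic_of_dim_le_three)
    (hD : Deligne1974_ker_restrictCompl_eq_iSup_range_complexGysin)
    (hV : Voisin2025_hodgeClass_lift_complexGysin)
    (hI : ∀ ⦃X Y : Motives.SchemeOver ℂ⦄ (f : X ⟶ Y),
      Motives.IsSmoothProjective 4 X → Motives.IsSmoothProjective 2 Y →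
      Function.Surjective f.left.base →
      (∀ y : Y.left, IsPreconnected (f.left.base ⁻¹' {y})) →
      (∃ T : Set Y.left, IsClosed T ∧ T ≠ Set.univ ∧
        ∀ s : Motives.AlgPoints Y ℂ, s.pt ∉ T →
          Motives.IsSmoothProjective 2 (Motives.fiberOver f s) ∧
          ∃ A : HodgeModel 2 (Motives.fiberOver f s), Module.finrank ℂ ↥(A.hodgePQ 2 2 0) = 0) →
      ∃ (X' : Motives.SchemeOver ℂ) (g : X' ⟶ X) (_ : Motives.IsSmoothProjective 4 X')
        (μ : HomologicalOrientation ℂ (Motives.ComplexPoints X') (2 * 4))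
        (ν : HomologicalOrientation ℂ (Motives.ComplexPoints X) (2 * 4)) (d : ℤ),
        d ≠ 0 ∧ HasDegree μ ν (Motives.AlgPoints.mapContinuous (L := ℂ) g) d ∧
        ∃ (D : Set X'.left) (_ : IsClosed D) (_ : D ≠ Set.univ)
          (V : Set (Motives.ComplexPoints X'))
          (_ : ∀ P : Motives.ComplexPoints X', P.pt ∉ D → P ∈ V)
          (N : ℕ) (e : Fin N → ℕ) (gen : ∀ j, complexBetti X' (e j)),
          (∀ j, complexBetti.restrictCompl X' D (e j) (gen j) = 0) ∧
          ∀ c : complexBetti X' (2 * 2),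
            singularCohomology.map ℂ ℂ
                (⟨Subtype.val, continuous_subtype_val⟩ :
                  C(↥V, Motives.ComplexPoints X')) (2 * 2) c ∈
              Submodule.span ℂ {x | ∃ (j : Fin N) (p : ℕ) (hpk : p + e j = 2 * 2)
                (u : singularCohomology ℂ ℂ ↥V p),
                cupProduct hpk u (singularCohomology.map ℂ ℂ
                  (⟨Subtype.val, continuous_subtype_val⟩ :
                    C(↥V, Motives.ComplexPoints X')) (e j) (gen j)) = x}) :
    Arapura2022_thm_1_2_smoothPart_pgZeroSurfaceFibration := by
  refine Arapura2022_thm_1_2_smoothPart_pgZeroSurfaceFibration_of_supportedClasses_eq_top h3 hD hV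
    fun X Y f hX hY hf hconn hgen ↦ ?_
  obtain ⟨X', g, hX', μ, ν, d, hd, hg, D, hDc, hDne, V, hDV, N, e, gen, hgen0, hspan⟩ :=
    hI f hX hY hf hconn hgen
  refine ⟨X', g, hX', μ, ν, d, hd, hg, ?_⟩
  exact supportedClasses_eq_top_of_map_mem_span_cupProduct hDc
    (fun z hz ↦ by
      rw [Nat.cast_one]
      exact one_le_coheight_of_mem_of_isClosed hX' hDc hDne hz)
    hDV gen hgen0 hspan

end HodgeTheory

end Literature.AlgebraicGeometry.HodgeTheory

end
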